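import Summits.QuantumFields.GaugeBoot.DiagonalRPTorusTwoZigzagAverage
import Summits.QuantumFields.GaugeBoot.DiagonalRPTorusGaugeInvariantFour
import HarnessLib

/-!
# Diagonal RP on the two-dimensional even torus HOLDS off the back layer: inner-half and
back-gauge-invariant observables (gauge-boot, task L3(η))

HONEST FRAMING (cell `pub-gaugeboot`, page 1 of every file): the venture produces certified bounds
on lattice expectations at stated coupling, gauge group, dimension and torus size; NOT a mass gap,
NOT a continuum limit, NOT a string tension; NOT Yang–Mills-summit-bearing (barriers
`FixedCouplingUltralocality`, `PerturbativeInvisibility`). This module is a small POSITIVE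
structural result about which positivity constraints a two-dimensional TORUS certificate may use
(no two-dimensional certificate with a diagonal block exists or is planned); it discharges nothing
else.

## Content

`DiagonalRPTorusNegative.lean` (L3(γ)) left open, verbatim, the case of "observables supported in
`0 ≤ k ≤ m < L/2` (strictly inside the half)". On the square torus `(ℤ/L)^d` with the diagonal
coordinate `k = y_i - y_j`, the closed half `0 ≤ k ≤ c` (`c = L/2`) of the swap `θ` has a true
mirror `k = 0` (fixed pointwise) and a BACK LAYER `k = c` (mapped to itself by a half-period
translation); every negative result of the cell about diagonal RP on the torus lives on that back
layer (L3(γ): back-layer links, `d ≥ 3`; L3(δ): the rungs into the back layer, `d = 2`;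
`DiagRPPolyakov`: back-layer Polyakov lines, `d ≥ 3`). This file settles the two-dimensional case
off the back layer. New notions (every `d`):

* `IsInnerHalfObservable i j F` — `F` depends only on links with both endpoints in the INNER half
  `0 ≤ k < c` (the closed half minus the back layer);
* `IsBackGaugeInvariant i j F` — `F` is invariant under the gauge transformations supported on the
  back layer (gauge functions equal to `1` off `k = c`); inner-half observables and gauge-invariant
  observables are such (`IsInnerHalfObservable.isBackGaugeInvariant`,
  `isBackGaugeInvariant_of_isGaugeInvariant`);
* `InnerDiagonalRP ρ β i j`, `BackInvariantDiagonalRP ρ β i j` — the statement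
  `0 ≤ ⟨(ΘF)‾ F⟩_{Λ,β}` for bounded measurable inner-half observables, resp. for bounded measurable
  back-gauge-invariant observables of the closed half; `DiagonalReflectionPositive →
  BackInvariantDiagonalRP → InnerDiagonalRP ∧ GaugeInvariantDiagonalRP`.

Main theorems (`d = 2`, `G` compact metrisable, `ρ` continuous — no hypothesis on the character):

* **`DiagRPTwo.backInvariantDiagonalRP_two`**: `BackInvariantDiagonalRP ρ β i j` on `(ℤ/L)²` for
  every even `L ≥ 4` and every `β ≥ 0`. In particular (`innerDiagonalRP_two`,
  `innerDiagonalRP_two_of_two_le`) **inner-half diagonal RP holds on every even two-torus**, for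
  ALL bounded measurable observables of the inner half, gauge-variant ones included — so the
  L3(δ) failure (`DiagRPTwo.not_diagonalReflectionPositive_two`, `β ≠ 0`) is carried exactly by
  gauge-variant observables touching the rungs into the back layer; and the gauge-invariant
  statements L3(ε)/L3(ζ) (`gaugeInvariantDiagonalRP_two_of_four_le`) are the special case
  `IsGaugeInvariant F` (`BackInvariantDiagonalRP.gaugeInvariantDiagonalRP`).
* `DiagRPTwo.backInvariantDiagonalRP_two_iff`: for a non-constant character,
  `BackInvariantDiagonalRP ρ β i j ↔ 4 ≤ L` (even `L ≥ 2`, `β ≥ 0`; the `2 × 2` torus fails already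
  in the gauge-invariant sector, `not_gaugeInvariantDiagonalRP_two_two`).

## Mechanism (`DiagonalRPTorusTwoZigzagAction.lean`, `DiagonalRPTorusTwoZigzagAverage.lean`)

With `g = F e^{β S_int}` (`gObs`), the crossing weight `E` (`crossE`) and
`Q̃(g₁, g₂) = ∫ g₁ conj(g₂ ∘ Θ) E dU`, the target is `Q̃(g, g) = ∫ rpPhi ≥ 0`
(`rpIntegrand_eq`), while the untwisted Osterwalder–Seiler inequality of
`DiagonalRPTorusTwoGram.lean` gives `Q̃(g, g ∘ T̂) ≥ 0` (`integral_twisted_nonneg`,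
`sum_gcoeff_mul_conj`; `T̂` the half-turn of the back zigzag). Now
`Q̃(g, g ∘ T̂) = Q̃(g ∘ T̂, g)` by the substitution `U ↦ T̂U` (`crossE_configTau`,
`configDiagSwap_configTau`), and `Q̃(g ∘ T̂, g) = Q̃(A(g ∘ T̂), g) = Q̃((Ag) ∘ T̂, g) = Q̃(Ag, g)
= Q̃(g, g)` where `A = zavg` averages over the fibrewise gauge action at the layer-`(c-1)` vertices
of the back zigzag (`integral_zavg_mul`, `zavg_comp_configTau`, `zavg_configTau`): the half-turn
of a cycle is a vertex gauge action, `Ag` is invariant under the layer-`(c-1)` action by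
construction and under the back-layer action because `F` is. Only `4 ≤ L` is used (no untwisting
maps `Ψ₁`, `Ψ₂`, no `L ≥ 6` step).

## Cell references and what is NOT claimed

This file settles, for `d = 2`, the open-half clause LOOP-SDP.md §3.4 (ii) of the loop lane
(pub-gaugeboot-loop), to be read with its sharpening LOOP-SDP-ADDENDUM-g30.md §2: there, in models
whose correlations PROPAGATE to the back layer (exact two-dimensional Ising toy; `d ≥ 3` gauge
theory expected), swap positivity over the full open-half observable space fails generically at
finite `L`. Two-dimensional lattice gauge theory is not such a model — the layers `c ± 1` could
only talk through links INSIDE the back layer, which `(ℤ/L)²` does not have, and the half-turn of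
the back zigzag is a vertex gauge action — which is exactly what the theorems below exploit; they
are calibration statements about the two-dimensional torus and license nothing. `d ≥ 3`: whether
inner-half (or back-gauge-invariant) diagonal RP holds on the torus is left OPEN here and, by the
addendum's identity §2 (a), is NOT expected for observables nearer to the back layer than to the
mirror; `β < 0`; odd `L`. No certificate of record uses a diagonal block (Class A = Gram + site +
link reflection positivity).

References: Osterwalder–Seiler, Ann. Phys. 110 (1978) 440, §2; Seiler, LNP 159 (1982) Ch. 2;
Kazakov–Zheng, arXiv:2203.11360 §3.1 (the three RP families on `ℤ^D`). The statements themselves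
are, as far as we searched, not in print.
Printed precedent (nearest-neighbour spin systems, a remark without proof): periodic boundary conditions destroy
diagonal RP — Fröhlich–Israel–Lieb–Simon, J. Stat. Phys. 22 (1980) 297, §3 (Model 3.1); M. Biskup, in LNM 1970
(2009) §5.5; the statements here are theorem-level, gauge-theoretic forms of that obstruction (tribunal t2 F-R1).
-/

open MeasureTheory Complex Finset Function
open scoped ComplexOrder ENNReal

namespace Summit.QuantumFields.GaugeBoot

open Literature.MathematicalPhysics.QuantumFieldTheory

noncomputable section

/-! ## The statements (every dimension) -/

section Statement

variable {d L N : ℕ} [NeZero L] {G : Type*} [Group G] [TopologicalSpace G] [IsTopologicalGroup G]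
  [CompactSpace G] [MeasurableSpace G] [BorelSpace G] (ρ : G →* Matrix (Fin N) (Fin N) ℂ)

/-- `F` is an observable of the INNER DIAGONAL HALF `{y : 0 ≤ (y_i - y_j) mod L < L/2}` (the
closed half `≤ L/2` minus its back layer `= L/2`): it depends only on the link variables of links
with both endpoints there. [shape] A parametric definition of a proposition — NOT a fact. [folklore] -/
def IsInnerHalfObservable {G α : Type*} (i j : Fin d) (F : GaugeConfig d L G → α) : Prop :=
  ∀ U V : GaugeConfig d L G,
    (∀ e : Edge d L, (e.1 i - e.1 j).val < L / 2 →
      ((e.1.shift e.2) i - (e.1.shift e.2) j).val < L / 2 → U e = V e) →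
    F U = F V

/-- `F` is invariant under the gauge transformations SUPPORTED ON THE BACK LAYER
`{y : y_i - y_j ≡ L/2}` (gauge functions equal to `1` off that layer). [shape] A parametric
definition of a proposition — NOT a fact. [folklore] -/
def IsBackGaugeInvariant {G α : Type*} [Group G] (i j : Fin d) (F : GaugeConfig d L G → α) : Prop :=
  ∀ γ : Site d L → G, (∀ y : Site d L, (y i - y j).val ≠ L / 2 → γ y = 1) →
    ∀ U : GaugeConfig d L G, F (gaugeTransform γ U) = F U

omit [NeZero L] [Group G] [TopologicalSpace G] [IsTopologicalGroup G] [CompactSpace G]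
  [MeasurableSpace G] [BorelSpace G] in
/-- An inner-half observable is a closed-half observable. -/
theorem IsInnerHalfObservable.isDiagonalHalfObservable {α : Type*} {i j : Fin d}
    {F : GaugeConfig d L G → α} (hF : IsInnerHalfObservable i j F) :
    IsDiagonalHalfObservable i j F :=
  fun U V hUV => hF U V fun e h1 h2 => hUV e h1.le h2.le

omit [NeZero L] [TopologicalSpace G] [IsTopologicalGroup G] [CompactSpace G] [MeasurableSpace G]
  [BorelSpace G] in
/-- An inner-half observable is invariant under the gauge transformations supported on the back
layer (its links do not meet that layer). -/
theorem IsInnerHalfObservable.isBackGaugeInvariant {α : Type*} {i j : Fin d}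
    {F : GaugeConfig d L G → α} (hF : IsInnerHalfObservable i j F) : IsBackGaugeInvariant i j F := by
  intro γ hγ U
  refine hF _ _ fun e h1 h2 => ?_
  rw [gaugeTransform, hγ _ h1.ne, hγ _ h2.ne, one_mul, inv_one, mul_one]

omit [NeZero L] [TopologicalSpace G] [IsTopologicalGroup G] [CompactSpace G] [MeasurableSpace G]
  [BorelSpace G] in
/-- A gauge-invariant observable is invariant under the gauge transformations supported on the
back layer. -/
theorem isBackGaugeInvariant_of_isGaugeInvariant {α : Type*} (i j : Fin d)
    {F : GaugeConfig d L G → α} (hF : IsGaugeInvariant F) : IsBackGaugeInvariant i j F :=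
  fun γ _ U => hF γ U

/-- **Inner-half diagonal reflection positivity on the torus**: `0 ≤ ⟨(ΘF)‾ F⟩_{Λ,β}` (real and
non-negative in `Complex.partialOrder`) for every bounded measurable observable `F` of the inner
diagonal half `{0 ≤ (y_i - y_j) mod L < L/2}`, `Θ = configDiagSwap i j`. [shape] A parametric
definition of a proposition — NOT a fact. [folklore] -/
def InnerDiagonalRP (β : ℝ) (i j : Fin d) : Prop :=
  ∀ (F : GaugeConfig d L G → ℂ), Measurable F → (∃ C : ℝ, ∀ U, ‖F U‖ ≤ C) →
    IsInnerHalfObservable i j F →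
      0 ≤ wilsonExpectation ρ β fun U => (starRingEnd ℂ) (F (configDiagSwap i j U)) * F U

/-- **Closed-half diagonal reflection positivity for back-gauge-invariant observables**:
`0 ≤ ⟨(ΘF)‾ F⟩_{Λ,β}` for every bounded measurable observable `F` of the closed diagonal half
`{0 ≤ (y_i - y_j) mod L ≤ L/2}` invariant under the gauge transformations supported on the back
layer `y_i - y_j ≡ L/2`. [shape] A parametric definition of a proposition — NOT a fact. [folklore] -/
def BackInvariantDiagonalRP (β : ℝ) (i j : Fin d) : Prop :=
  ∀ (F : GaugeConfig d L G → ℂ), Measurable F → (∃ C : ℝ, ∀ U, ‖F U‖ ≤ C) →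
    IsDiagonalHalfObservable i j F → IsBackGaugeInvariant i j F →
      0 ≤ wilsonExpectation ρ β fun U => (starRingEnd ℂ) (F (configDiagSwap i j U)) * F U

/-- The back-gauge-invariant statement is a weakening of the full closed-half statement. -/
theorem DiagonalReflectionPositive.backInvariantDiagonalRP {β : ℝ} {i j : Fin d}
    (h : DiagonalReflectionPositive (d := d) (L := L) ρ β i j) :
    BackInvariantDiagonalRP (d := d) (L := L) ρ β i j :=
  fun F hF hFb hFH _ => h F hF hFb hFH

/-- The back-gauge-invariant statement implies the inner-half statement. -/
theorem BackInvariantDiagonalRP.innerDiagonalRP {β : ℝ} {i j : Fin d}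
    (h : BackInvariantDiagonalRP (d := d) (L := L) ρ β i j) :
    InnerDiagonalRP (d := d) (L := L) ρ β i j :=
  fun F hF hFb hFI => h F hF hFb hFI.isDiagonalHalfObservable hFI.isBackGaugeInvariant

/-- The back-gauge-invariant statement implies the gauge-invariant statement. -/
theorem BackInvariantDiagonalRP.gaugeInvariantDiagonalRP {β : ℝ} {i j : Fin d}
    (h : BackInvariantDiagonalRP (d := d) (L := L) ρ β i j) :
    GaugeInvariantDiagonalRP (d := d) (L := L) ρ β i j :=
  fun F hF hFb hFH hFg => h F hF hFb hFH (isBackGaugeInvariant_of_isGaugeInvariant i j hFg)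

end Statement

namespace DiagRPTwo

/-! ## The back-layer hypothesis in two dimensions -/

section BackTwo

variable {L : ℕ} [NeZero L] {i j : Fin 2} {G α : Type*} [Group G]

/-- In the language of `DiagonalRPTorusTwoGeometry.lean`: a back-gauge-invariant observable is
invariant under every gauge function equal to `1` off `k = c` (`L ≥ 4`). -/
theorem apply_gaugeTransform_of_isBackGaugeInvariant (h4 : 4 ≤ L) {F : GaugeConfig 2 L G → α}
    (hF : IsBackGaugeInvariant i j F) (γ : Site 2 L → G) (hγ : ∀ y, kd i j y ≠ cc L → γ y = 1)
    (U : GaugeConfig 2 L G) : F (gaugeTransform γ U) = F U :=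
  hF γ (fun y hy => hγ y fun h => hy ((kd_eq_cc_iff h4 y).1 h)) U

end BackTwo

/-! ## Removing the twist by averaging -/

section Main

variable {L N : ℕ} [NeZero L] {G : Type*} [Group G] [TopologicalSpace G] [IsTopologicalGroup G]
  [CompactSpace G] [MeasurableSpace G] [BorelSpace G] [SecondCountableTopology G]
  (ρ : G →* Matrix (Fin N) (Fin N) ℂ)

/-- **Removing the twist**: for a back-gauge-invariant observable of the closed half,
`∫ g conj(g∘Θ') exp(Σ a conj(a∘Θ')) = ∫ g conj(g∘Θ) E` (`L ≥ 4` even, `β ≥ 0`). -/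
theorem integral_twisted_eq_of_back (hL : Even L) (h4 : 4 ≤ L) {i j : Fin 2} (hij : i ≠ j)
    (hρ : Continuous ρ) {β : ℝ} (hβ : 0 ≤ β) {F : GaugeConfig 2 L G → ℂ} (hF : Measurable F)
    {CF : ℝ} (hFb : ∀ U, ‖F U‖ ≤ CF) (hFH : IsDiagonalHalfObservable i j F)
    (hFB : ∀ γ : Site 2 L → G, (∀ y, kd i j y ≠ cc L → γ y = 1) →
      ∀ U, F (gaugeTransform γ U) = F U) :
    ∫ U, gObs ρ i j β F U * (starRingEnd ℂ) (gObs ρ i j β F (configTwistSwap i j U)) *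
        Complex.exp (∑ ι, gcoeff ρ i j hρ β ι U *
          (starRingEnd ℂ) (gcoeff ρ i j hρ β ι (configTwistSwap i j U))) ∂(linkMeasure L G) =
      ∫ U, rpPhi ρ i j β F U ∂(linkMeasure L G) := by
  -- abbreviations and their regularity
  set g : GaugeConfig 2 L G → ℂ := gObs ρ i j β F with hg_def
  set Φ : GaugeConfig 2 L G → ℂ := fun U =>
    (starRingEnd ℂ) (g (configDiagSwap i j U)) * (crossE ρ i j β U : ℂ) with hΦ_def
  have hgm : Measurable g := measurable_gObs ρ i j hρ β hF
  have hgb : ∀ U, ‖g U‖ ≤ CF * Real.exp (|β| * ((Sp (L := L) i j).card * N)) :=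
    norm_gObs_le ρ i j hρ β hFb
  have hgH : DependsOn g (halfLinks (L := L) i j : Set (Edge 2 L)) := dependsOn_gObs ρ h4 hij β hFH
  have hgB : ∀ k U, g (zig i j (onB i j k) U) = g U := gObs_zig_onB ρ h4 hij β hFH hFB
  have hΘm : Measurable (configDiagSwap (G := G) (L := L) i j) :=
    measurable_pi_lambda _ fun e => measurable_pi_apply _
  have hTm : Measurable (configTau (G := G) (L := L) i j) :=
    measurable_pi_lambda _ fun e => measurable_pi_apply _
  have hsum : ∀ S : Finset (Site 2 L), Measurable fun U : GaugeConfig 2 L G => ∑ y ∈ S, rr ρ i j U y :=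
    fun S => Finset.measurable_sum _ fun y _ => measurable_rr ρ hρ i j y
  have hEm : Measurable fun U : GaugeConfig 2 L G => (crossE ρ i j β U : ℂ) :=
    Complex.measurable_ofReal.comp ((((hsum _).add (hsum _)).const_mul β).exp)
  have hΦm : Measurable Φ :=
    (Complex.continuous_conj.measurable.comp (hgm.comp hΘm)).mul hEm
  have hΦb : ∀ U, ‖Φ U‖ ≤ CF * Real.exp (|β| * ((Sp (L := L) i j).card * N)) *
      Real.exp (|β| * (((S0 (L := L) i j).card + (Sc (L := L) i j).card) * N)) := fun U => by
    rw [hΦ_def, norm_mul, RCLike.norm_conj, Complex.norm_real, Real.norm_eq_abs,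
      abs_of_pos (by unfold crossE; exact Real.exp_pos _)]
    exact mul_le_mul (hgb _) (crossE_le ρ hρ β U) (by unfold crossE; exact (Real.exp_pos _).le)
      ((norm_nonneg _).trans (hgb U))
  have hΦz : ∀ k U, Φ (zig i j (onA i j k) U) = Φ U := fun k U => by
    simp only [hΦ_def, comp_configDiagSwap_zig hL h4 hij hgH, crossE_zig_onA ρ h4 hij]
  -- (a) the twisted integrand is `g(U) conj g(T̂ΘU) E(U)`
  have ha : ∀ U : GaugeConfig 2 L G,
      g U * (starRingEnd ℂ) (g (configTwistSwap i j U)) *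
        Complex.exp (∑ ι, gcoeff ρ i j hρ β ι U *
          (starRingEnd ℂ) (gcoeff ρ i j hρ β ι (configTwistSwap i j U))) =
        g U * (starRingEnd ℂ) (g (configTau i j (configDiagSwap i j U))) * (crossE ρ i j β U : ℂ) :=
    fun U => by
      rw [sum_gcoeff_mul_conj ρ hL h4 hij hρ hβ, ← Complex.ofReal_exp, configTwistSwap_eq, crossE]
  simp_rw [ha]
  -- (b) substitute `U ↦ T̂U`: `Q̃(g, g∘T̂) = Q̃(g∘T̂, g)`
  have hb : ∫ U, g U * (starRingEnd ℂ) (g (configTau i j (configDiagSwap i j U))) *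
      (crossE ρ i j β U : ℂ) ∂(linkMeasure L G) =
      ∫ U, g (configTau i j U) * Φ U ∂(linkMeasure L G) := by
    have h := LatticeRP.integral_comp_eq_of_measurePreserving (measurePreserving_configTau hL i j)
      (Φ := fun U => g U * (starRingEnd ℂ) (g (configTau i j (configDiagSwap i j U))) *
        (crossE ρ i j β U : ℂ))
      ((hgm.mul (Complex.continuous_conj.measurable.comp (hgm.comp (hTm.comp hΘm)))).mul hEm)
    rw [← h]
    refine integral_congr_ae (Filter.Eventually.of_forall fun U => ?_)
    simp only [hΦ_def, configTau_configDiagSwap_configTau hL, crossE_configTau ρ hL h4 hij, mul_assoc]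
  rw [hb]
  -- (c)–(e) average over the layer-`(c-1)` action
  have hc : ∫ U, g (configTau i j U) * Φ U ∂(linkMeasure L G) =
      ∫ U, zavg i j (fun V => g (configTau i j V)) U * Φ U ∂(linkMeasure L G) :=
    (integral_zavg_mul (hgm.comp hTm) (fun U => hgb _) hΦm hΦb hΦz).symm
  have hd : ∀ U, zavg i j (fun V => g (configTau i j V)) U = zavg i j g U := fun U => by
    rw [zavg_comp_configTau hL hgm, zavg_configTau h4 hij hgm hgH hgB]
  rw [hc]
  simp_rw [hd]
  rw [integral_zavg_mul hgm hgb hΦm hΦb hΦz]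
  refine integral_congr_ae (Filter.Eventually.of_forall fun U => ?_)
  simp only [hΦ_def, rpPhi, hg_def, mul_assoc]

/-- **The untwisted inequality, back-gauge-invariant form**: `0 ≤ ∫ g conj(g∘Θ) E dU`
(`L ≥ 4` even, `β ≥ 0`). -/
theorem integral_rpPhi_nonneg_of_back (hL : Even L) (h4 : 4 ≤ L) {i j : Fin 2} (hij : i ≠ j)
    (hρ : Continuous ρ) {β : ℝ} (hβ : 0 ≤ β) {F : GaugeConfig 2 L G → ℂ} (hF : Measurable F)
    {CF : ℝ} (hFb : ∀ U, ‖F U‖ ≤ CF) (hFH : IsDiagonalHalfObservable i j F)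
    (hFB : ∀ γ : Site 2 L → G, (∀ y, kd i j y ≠ cc L → γ y = 1) →
      ∀ U, F (gaugeTransform γ U) = F U) :
    0 ≤ ∫ U, rpPhi ρ i j β F U ∂(linkMeasure L G) := by
  rw [← integral_twisted_eq_of_back ρ hL h4 hij hρ hβ hF hFb hFH hFB]
  exact integral_twisted_nonneg ρ hL h4 hij hρ β hF hFb hFH

/-- **L3(η): diagonal reflection positivity HOLDS on the two-dimensional even torus for
observables of the closed half invariant under the back-layer gauge transformations.** Let
`L ≥ 4` be even, `G` a compact metrisable group, `ρ` a continuous finite-dimensional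
representation, `β ≥ 0`, `i ≠ j`. Then for every bounded measurable observable `F` of the closed
diagonal half `{0 ≤ (y_i - y_j) mod L ≤ L/2}` with `F(U^γ) = F(U)` for all gauge functions `γ`
equal to `1` off the back layer `y_i - y_j ≡ L/2`, `0 ≤ ⟨(ΘF)‾ F⟩_{Λ,β}`. -/
theorem wilsonExpectation_swap_nonneg_of_isBackGaugeInvariant (hL : Even L) (h4 : 4 ≤ L)
    (hρ : Continuous ρ) {β : ℝ} (hβ : 0 ≤ β) {i j : Fin 2} (hij : i ≠ j)
    {F : GaugeConfig 2 L G → ℂ} (hF : Measurable F) (hFb : ∃ C : ℝ, ∀ U, ‖F U‖ ≤ C)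
    (hFH : IsDiagonalHalfObservable i j F) (hFB : IsBackGaugeInvariant i j F) :
    0 ≤ wilsonExpectation ρ β fun U => (starRingEnd ℂ) (F (configDiagSwap i j U)) * F U := by
  obtain ⟨CF, hFb⟩ := hFb
  have hFB' : ∀ γ : Site 2 L → G, (∀ y, kd i j y ≠ cc L → γ y = 1) →
      ∀ U, F (gaugeTransform γ U) = F U :=
    fun γ hγ U => apply_gaugeTransform_of_isBackGaugeInvariant h4 hFB γ hγ U
  have hdens : Measurable fun U : GaugeConfig 2 L G =>
      ENNReal.ofReal (Real.exp (-β * wilsonAction ρ U)) :=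
    ENNReal.measurable_ofReal.comp ((WilsonRP.measurable_wilsonAction ρ hρ).const_mul (-β)).exp
  unfold wilsonExpectation wilsonMeasure
  rw [integral_smul_measure]
  unfold wilsonWeight
  rw [integral_withDensity_eq_integral_toReal_smul hdens (ae_of_all _ fun _ => ENNReal.ofReal_lt_top)]
  simp_rw [ENNReal.toReal_ofReal (Real.exp_nonneg _), Complex.real_smul]
  refine mul_nonneg (Complex.zero_le_real.2 ENNReal.toReal_nonneg) ?_
  simp_rw [rpIntegrand_eq ρ hL h4 hij hρ β F]
  rw [integral_const_mul]
  exact mul_nonneg (Complex.zero_le_real.2 (Real.exp_pos _).le)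
    (integral_rpPhi_nonneg_of_back ρ hL h4 hij hρ hβ hF hFb hFH hFB')

/-- **L3(η), packaged**: `BackInvariantDiagonalRP ρ β i j` holds on `(ℤ/L)²`, `L ≥ 4` even,
`β ≥ 0`. -/
theorem backInvariantDiagonalRP_two (hL : Even L) (h4 : 4 ≤ L) (hρ : Continuous ρ) {β : ℝ}
    (hβ : 0 ≤ β) {i j : Fin 2} (hij : i ≠ j) :
    BackInvariantDiagonalRP (d := 2) (L := L) ρ β i j :=
  fun _ hF hFb hFH hFB =>
    wilsonExpectation_swap_nonneg_of_isBackGaugeInvariant ρ hL h4 hρ hβ hij hF hFb hFH hFB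

/-- **Inner-half diagonal RP holds on `(ℤ/L)²`, `L ≥ 4` even, `β ≥ 0`** — for ALL bounded
measurable observables supported off the back layer, gauge-variant ones included (contrast
L3(δ), `not_diagonalReflectionPositive_two`: the closed-half statement fails for `β ≠ 0`). -/
theorem innerDiagonalRP_two (hL : Even L) (h4 : 4 ≤ L) (hρ : Continuous ρ) {β : ℝ} (hβ : 0 ≤ β)
    {i j : Fin 2} (hij : i ≠ j) : InnerDiagonalRP (d := 2) (L := L) ρ β i j :=
  (backInvariantDiagonalRP_two ρ hL h4 hρ hβ hij).innerDiagonalRP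

end Main

/-! ## The `2 × 2` torus and the classification -/

section TwoByTwo

variable {N : ℕ} {G : Type*} [Group G] [TopologicalSpace G] [IsTopologicalGroup G]
  [CompactSpace G] [MeasurableSpace G] [BorelSpace G] (ρ : G →* Matrix (Fin N) (Fin N) ℂ)

omit [Group G] [TopologicalSpace G] [IsTopologicalGroup G] [CompactSpace G] [MeasurableSpace G]
  [BorelSpace G] in
/-- On the `2 × 2` torus the inner half carries no link: an inner-half observable is constant. -/
theorem eq_of_isInnerHalfObservable_two {α : Type*} {i j : Fin 2} (hij : i ≠ j)
    {F : GaugeConfig 2 2 G → α} (hF : IsInnerHalfObservable i j F) (U V : GaugeConfig 2 2 G) :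
    F U = F V :=
  hF U V fun e h1 h2 => absurd (And.intro h1 h2)
    ((by decide : ∀ a b : Fin 2, a ≠ b → ∀ e : Edge 2 2,
        ¬((e.1 a - e.1 b).val < 2 / 2 ∧ ((e.1.shift e.2) a - (e.1.shift e.2) b).val < 2 / 2)) i j hij e)

/-- **Inner-half diagonal RP on the `2 × 2` torus** (trivially: inner-half observables are
constants), every real `β`. -/
theorem innerDiagonalRP_two_two (β : ℝ) {i j : Fin 2} (hij : i ≠ j) :
    InnerDiagonalRP (d := 2) (L := 2) ρ β i j := by
  intro F _ _ hFI
  have hc : ∀ U, F U = F 1 := fun U => eq_of_isInnerHalfObservable_two hij hFI U 1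
  have h1 : (fun U : GaugeConfig 2 2 G => (starRingEnd ℂ) (F (configDiagSwap i j U)) * F U) =
      fun _ => (starRingEnd ℂ) (F 1) * F 1 := funext fun U => by rw [hc, hc U]
  rw [wilsonExpectation, h1, integral_const, Complex.real_smul]
  exact mul_nonneg (Complex.zero_le_real.2 measureReal_nonneg)
    (by rw [starRingEnd_apply]; exact star_mul_self_nonneg _)

/-- **Inner-half diagonal RP holds on EVERY even two-torus** (`L ≥ 2` even, `β ≥ 0`). -/
theorem innerDiagonalRP_two_of_two_le {L : ℕ} [NeZero L] [SecondCountableTopology G]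
    (hL : Even L) (h2 : 2 ≤ L) (hρ : Continuous ρ) {β : ℝ} (hβ : 0 ≤ β) {i j : Fin 2}
    (hij : i ≠ j) : InnerDiagonalRP (d := 2) (L := L) ρ β i j := by
  by_cases h4 : 4 ≤ L
  · exact innerDiagonalRP_two ρ hL h4 hρ hβ hij
  · obtain ⟨r, hr⟩ := hL
    obtain rfl : L = 2 := by omega
    exact innerDiagonalRP_two_two ρ β hij

/-- **Classification, back-gauge-invariant sector**: on `(ℤ/L)²`, `L ≥ 2` even, `β ≥ 0`, `G`
compact metrisable and `ρ` continuous with non-constant character,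
`BackInvariantDiagonalRP ρ β i j ↔ 4 ≤ L` (the `2 × 2` torus fails already for gauge-invariant
observables, `not_gaugeInvariantDiagonalRP_two_two`). -/
theorem backInvariantDiagonalRP_two_iff {L : ℕ} [NeZero L] [SecondCountableTopology G] [T2Space G]
    (hL : Even L) (h2 : 2 ≤ L) (hρ : Continuous ρ) (hρN : ∃ g, ((ρ g).trace).re ≠ N) {β : ℝ}
    (hβ : 0 ≤ β) {i j : Fin 2} (hij : i ≠ j) :
    BackInvariantDiagonalRP (d := 2) (L := L) ρ β i j ↔ 4 ≤ L :=
  ⟨fun h => (gaugeInvariantDiagonalRP_two_iff ρ hL h2 hρ hρN hβ hij).1 h.gaugeInvariantDiagonalRP,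
    fun h4 => backInvariantDiagonalRP_two ρ hL h4 hρ hβ hij⟩

end TwoByTwo

end DiagRPTwo

end

end Summit.QuantumFields.GaugeBoot
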